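import Literature.NumberTheory.Automorphic.AdelicHeightGLProofs
import Literature.NumberTheory.Automorphic.AdeleRingTopology
import HarnessLib

/-!
# Finite heights on `GL_N(𝔸_{K,f})`: exact local heights, global denominators, coset separation

Track B ∕ hLiu418 = stmt-HodgeConjecture-24832, line `K2_Liu_CurveThetaSigs`, unit U5 «DOUBLING ZETA», organ (IV-d)
of socket #16b `sig_K2LiuAdelicNormIntegrable` (Weil's adelic integrability of `‖g‖^{-β}`), plan
`K2/K2Liu-p03/g2/PLAN-16b-AdelicNormIntegrable.v1.K2Liu-p03-g2.md` (steward K2Liu-p03 (g2)), FILE 3 of 6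
(seat `hodgecm-mathlib-K2Liu-p06` (g0)): the FINITE-ADELIC ALGEBRA behind the count of the cosets
`y · GL_N(𝒪̂_K)` of `GL_N(𝔸_{K,f})` of bounded finite height `H_f(y) = ∏_v H_v(y) ≤ T` (file 4,
`K2LiuFiniteHeightCosetCount`, consumes the statements below).

Borel–Jacquet's local heights `H_v(g) = max_{i,j} (|g_{ij}|_v ⊔ |(g⁻¹)_{ij}|_v)` (★ `GLn.localHeight`,
`Literature.NumberTheory.Automorphic.AdelicGLnGlue`; [BorelJacquet1979, §1.2], [MoeglinWaldspurger1995, §I.2.2]) only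
see the finite part of `g` (§1), are EXACT powers `q_v^{e_v}` of the residue cardinality (§2, `H_v ≥ 1` is a maximum of
normalised absolute values `|x|_v = q_v^{-ord_v x}`), so that the finite height `n_y := ∏_v H_v(y)` of
`y ∈ GL_N(𝔸_{K,f})` is a natural number which is a GLOBAL DENOMINATOR of `y` and `y⁻¹`: `n_y · y` and `n_y · y⁻¹` have
entries in `𝒪̂_K` (§3 = (F-a) of the plan: `q_v = #(𝓞_K ∕ v) ∈ v`, Mathlib `Ideal.absNorm_mem`, so `|n_y|_v ≤ q_v^{-e_v}`).
§4 is the SEPARATION LEMMA (F-b): if `c · y⁻¹` and `c · y′⁻¹` are integral and `y′ ≡ y (mod c · M_N(𝒪̂_K))` then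
`y⁻¹ y′ ∈ GL_N(𝒪̂_K)`, i.e. `y` and `y′` span the same coset — in particular (memo form) `n·y⁻¹`, `n·y′⁻¹` integral and
`n·y ≡ n·y′ (mod n² M_N(𝒪̂_K))` force `y GL_N(𝒪̂_K) = y′ GL_N(𝒪̂_K)`; this is what makes the residues of `n·y` modulo `n²`
COUNT the cosets of height `n` [MoeglinWaldspurger1995, §I.2.2 (finiteness properties of the height)].

Theorems only (no definition, no instance, no named fact); axioms ⊆ {propext, Classical.choice, Quot.sound}.

## References
* A. Borel, H. Jacquet, *Automorphic forms and automorphic representations*, PSPM 33.1 (1979), §1.2 [BorelJacquet1979].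
* C. Moeglin, J.-L. Waldspurger, *Spectral decomposition and Eisenstein series* (1995), §I.2.2 [MoeglinWaldspurger1995].
* J. W. S. Cassels, A. Fröhlich (eds.), *Algebraic Number Theory* (1967), Ch. II §§14–16 [CasselsFrohlichANT1967].

HONEST LABEL: HC_CM is proved only modulo the 7 printed citations (2 remaining named inputs: hLiu418 =
stmt-HodgeConjecture-24832, h413 = stmt-HodgeConjecture-24833) until rung 0 closes; this helper moves no counter.
-/

noncomputable section

set_option autoImplicit false

set_option linter.dupNamespace false

open scoped MatrixGroups NNReal
open NumberField IsDedekindDomain WithZeroMulInt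
open Literature.NumberTheory.Automorphic

namespace Summit.HodgeConjecture.HodgeConjecture.Cruxes.HLiu418.K2LiuFiniteHeightCosetSeparation

variable {K : Type} [Field K] [NumberField K] {N : ℕ}

/-! ## §1 The local heights only see the finite part -/

/-- The `v`-component of `GLn.ofFinite y` is the matrix `(y_{ij,v})` of `v`-components of the entries of `y`. [folklore] -/
theorem coe_map_adeleEval_ofFinite_apply (v : HeightOneSpectrum (𝓞 K))
    (y : GL (Fin N) (FiniteAdeleRing (𝓞 K) K)) (i j : Fin N) :
    (Matrix.GeneralLinearGroup.map (AdelicGroupData.adeleEval K v) (GLn.ofFinite N K y) :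
        Matrix (Fin N) (Fin N) (v.adicCompletion K)) i j =
      ((y : Matrix (Fin N) (Fin N) (FiniteAdeleRing (𝓞 K) K)) i j) v := by
  rw [AdelicGroupData.coe_map_adeleEval_apply, AdelicGroupData.adeleEval_apply, GLn.coe_ofFinite_apply]

/-- **`H_v(g) = H_v((1, g_f))`**: the local height at a finite place depends only on the finite part `g_f = GLn.sndHom g`
of `g ∈ GL_N(𝔸_K)` (both are the height of the same matrix `g_v ∈ GL_N(K_v)`). [cite: BorelJacquet1979, §1.2] -/
theorem localHeight_eq_localHeight_ofFinite_sndHom (v : HeightOneSpectrum (𝓞 K))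
    (g : GL (Fin N) (AdeleRing (𝓞 K) K)) :
    GLn.localHeight N K v g = GLn.localHeight N K v (GLn.ofFinite N K (GLn.sndHom N K g)) := by
  have h : Matrix.GeneralLinearGroup.map (AdelicGroupData.adeleEval K v) g =
      Matrix.GeneralLinearGroup.map (AdelicGroupData.adeleEval K v)
        (GLn.ofFinite N K (GLn.sndHom N K g)) := by
    refine Matrix.GeneralLinearGroup.ext fun i j => ?_
    rw [coe_map_adeleEval_ofFinite_apply, AdelicGroupData.coe_map_adeleEval_apply,
      AdelicGroupData.adeleEval_apply]
    rfl
  unfold GLn.localHeight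
  rw [h]

/-- Entries are bounded by the local height: `|y_{ij}|_v ≤ H_v(y)` for `y ∈ GL_N(𝔸_{K,f})`. [cite: BorelJacquet1979, §1.2] -/
theorem nnnorm_apply_le_localHeight (v : HeightOneSpectrum (𝓞 K))
    (y : GL (Fin N) (FiniteAdeleRing (𝓞 K) K)) (i j : Fin N) :
    ‖((y : Matrix (Fin N) (Fin N) (FiniteAdeleRing (𝓞 K) K)) i j) v‖₊ ≤
      GLn.localHeight N K v (GLn.ofFinite N K y) := by
  rw [← coe_map_adeleEval_ofFinite_apply]
  exact nnnorm_apply_le_sup _ i j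

/-- Entries of the inverse are bounded by the local height: `|(y⁻¹)_{ij}|_v ≤ H_v(y)`. [cite: BorelJacquet1979, §1.2] -/
theorem nnnorm_inv_apply_le_localHeight (v : HeightOneSpectrum (𝓞 K))
    (y : GL (Fin N) (FiniteAdeleRing (𝓞 K) K)) (i j : Fin N) :
    ‖(((y⁻¹ : GL (Fin N) (FiniteAdeleRing (𝓞 K) K)) :
        Matrix (Fin N) (Fin N) (FiniteAdeleRing (𝓞 K) K)) i j) v‖₊ ≤
      GLn.localHeight N K v (GLn.ofFinite N K y) := by
  rw [← coe_map_adeleEval_ofFinite_apply, map_inv, map_inv]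
  exact nnnorm_inv_apply_le_sup _ i j

/-! ## §2 Local heights are exact powers of the residue cardinality -/

/-- On `K_v` the normalised absolute value takes the values `0` and `q_v^m`, `m ∈ ℤ` (`q_v = #(𝓞_K ∕ v)`): for `x ≠ 0`,
`‖x‖ = q_v^{-ord_v x}` (Mathlib `FinitePlace.norm_def`). [folklore] -/
theorem exists_nnnorm_eq_absNorm_zpow (v : HeightOneSpectrum (𝓞 K)) {x : v.adicCompletion K}
    (hx : x ≠ 0) : ∃ m : ℤ, ‖x‖₊ = ((Ideal.absNorm v.asIdeal : ℕ) : ℝ≥0) ^ m := by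
  have hvx : (Valued.v x : WithZero (Multiplicative ℤ)) ≠ 0 := (Valuation.ne_zero_iff _).2 hx
  refine ⟨(WithZero.unzero hvx).toAdd, ?_⟩
  apply NNReal.coe_injective
  rw [coe_nnnorm, NumberField.FinitePlace.norm_def,
    toNNReal_neg_apply (NumberField.HeightOneSpectrum.absNorm_ne_zero v) hvx]

/-- **Exactness of the local heights**: for `N ≥ 1`, `H_v(g) = q_v^{e}` for some `e : ℕ`, where `q_v = #(𝓞_K ∕ v)` is the
residue cardinality (`H_v(g) ≥ 1` is the maximum of finitely many absolute values `q_v^{m}`, `m ∈ ℤ`).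
[cite: MoeglinWaldspurger1995, §I.2.2] -/
theorem exists_localHeight_eq_absNorm_pow [NeZero N] (v : HeightOneSpectrum (𝓞 K))
    (g : GL (Fin N) (AdeleRing (𝓞 K) K)) :
    ∃ e : ℕ, GLn.localHeight N K v g = ((Ideal.absNorm v.asIdeal : ℕ) : ℝ≥0) ^ e := by
  classical
  set q : ℝ≥0 := ((Ideal.absNorm v.asIdeal : ℕ) : ℝ≥0) with hqdef
  have hq : 1 < q := NumberField.HeightOneSpectrum.one_lt_absNorm_nnreal v
  set G := Matrix.GeneralLinearGroup.map (AdelicGroupData.adeleEval K v) g with hGdef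
  -- the height is attained at some entry of `g_v` or `g_v⁻¹`
  haveI : Nonempty (Fin N) := ⟨⟨0, Nat.pos_of_ne_zero (NeZero.ne N)⟩⟩
  obtain ⟨ij, -, hij⟩ := Finset.exists_mem_eq_sup (Finset.univ : Finset (Fin N × Fin N))
    Finset.univ_nonempty (fun ij : Fin N × Fin N =>
      ‖(G : Matrix (Fin N) (Fin N) (v.adicCompletion K)) ij.1 ij.2‖₊ ⊔
        ‖((G⁻¹ : GL (Fin N) (v.adicCompletion K)) : Matrix (Fin N) (Fin N) (v.adicCompletion K))
          ij.1 ij.2‖₊)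
  have hH : GLn.localHeight N K v g =
      ‖(G : Matrix (Fin N) (Fin N) (v.adicCompletion K)) ij.1 ij.2‖₊ ⊔
        ‖((G⁻¹ : GL (Fin N) (v.adicCompletion K)) : Matrix (Fin N) (Fin N) (v.adicCompletion K))
          ij.1 ij.2‖₊ := hij
  obtain ⟨x, hx⟩ : ∃ x : v.adicCompletion K, GLn.localHeight N K v g = ‖x‖₊ := by
    rcases max_choice ‖(G : Matrix (Fin N) (Fin N) (v.adicCompletion K)) ij.1 ij.2‖₊
      ‖((G⁻¹ : GL (Fin N) (v.adicCompletion K)) : Matrix (Fin N) (Fin N) (v.adicCompletion K))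
        ij.1 ij.2‖₊ with h | h
    · exact ⟨_, hH.trans h⟩
    · exact ⟨_, hH.trans h⟩
  -- this entry is non-zero since `H_v(g) ≥ 1`
  have h1 : 1 ≤ GLn.localHeight N K v g := GLn.one_le_localHeight v g
  have hx0 : x ≠ 0 := by
    rintro rfl
    rw [hx, nnnorm_zero] at h1
    exact not_lt.2 h1 zero_lt_one
  obtain ⟨m, hm⟩ := exists_nnnorm_eq_absNorm_zpow v hx0
  have hm0 : 0 ≤ m := (one_le_zpow_iff_right₀ hq).1 (by rw [← hm, ← hx]; exact h1)
  refine ⟨m.toNat, ?_⟩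
  rw [hx, hm, ← zpow_natCast, Int.toNat_of_nonneg hm0]

/-- `H_v(g) ≠ 1` forces a positive exponent: if `H_v(g) = q_v^e` and `H_v(g) ≠ 1` then `e ≠ 0`; equivalently
`H_v(g) = 1 ⇒ e = 0`. Plumbing for the global denominator. [folklore] -/
theorem eq_zero_of_absNorm_pow_eq_one (v : HeightOneSpectrum (𝓞 K)) {e : ℕ}
    (h : ((Ideal.absNorm v.asIdeal : ℕ) : ℝ≥0) ^ e = 1) : e = 0 := by
  by_contra he
  exact absurd h (one_lt_pow₀ (NumberField.HeightOneSpectrum.one_lt_absNorm_nnreal v) he).ne'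

/-! ## §3 The finite height is a natural number and a global denominator (F-a) -/

/-- **`|q_v|_v ≤ q_v⁻¹`**: the residue cardinality `q_v = #(𝓞_K ∕ v)` lies in `v` (Mathlib `Ideal.absNorm_mem`), so its
image in `K_v` has absolute value `≤ q_v^{-1}`. [folklore] -/
theorem nnnorm_natCast_absNorm_le (v : HeightOneSpectrum (𝓞 K)) :
    ‖((Ideal.absNorm v.asIdeal : ℕ) : v.adicCompletion K)‖₊ ≤
      (((Ideal.absNorm v.asIdeal : ℕ) : ℝ≥0) ^ (1 : ℕ))⁻¹ := by
  have hmem : ((Ideal.absNorm v.asIdeal : ℕ) : 𝓞 K) ∈ v.asIdeal ^ 1 := by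
    rw [pow_one]; exact Ideal.absNorm_mem v.asIdeal
  have hval : v.intValuation ((Ideal.absNorm v.asIdeal : ℕ) : 𝓞 K) ≤ WithZero.exp (-((1 : ℕ) : ℤ)) :=
    (v.intValuation_le_pow_iff_mem _ 1).2 hmem
  have hcast : ((Ideal.absNorm v.asIdeal : ℕ) : v.adicCompletion K) =
      NumberField.FinitePlace.embedding v (algebraMap (𝓞 K) K ((Ideal.absNorm v.asIdeal : ℕ) : 𝓞 K)) := by
    rw [map_natCast, map_natCast]
  apply NNReal.coe_le_coe.1
  rw [coe_nnnorm, hcast, NumberField.FinitePlace.norm_embedding_int]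
  have hmono := (toNNReal_strictMono (NumberField.HeightOneSpectrum.one_lt_absNorm_nnreal v)).monotone hval
  refine (NNReal.coe_le_coe.2 hmono).trans_eq ?_
  rw [toNNReal_neg_apply _ WithZero.exp_ne_zero]
  push_cast
  rw [← zpow_natCast, ← zpow_neg]
  rfl

/-- The absolute value of a natural number at a finite place is `≤ 1`. [folklore] -/
theorem nnnorm_natCast_le_one (v : HeightOneSpectrum (𝓞 K)) (m : ℕ) :
    ‖((m : ℕ) : v.adicCompletion K)‖₊ ≤ 1 := by
  have hcast : ((m : ℕ) : v.adicCompletion K) =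
      NumberField.FinitePlace.embedding v (algebraMap (𝓞 K) K ((m : ℕ) : 𝓞 K)) := by
    rw [map_natCast, map_natCast]
  apply NNReal.coe_le_coe.1
  rw [coe_nnnorm, hcast]
  exact NumberField.FinitePlace.norm_le_one K v _

/-- If `q_v^e` divides the natural number `n` then `|n|_v ≤ q_v^{-e}`. [folklore] -/
theorem nnnorm_natCast_le_of_dvd (v : HeightOneSpectrum (𝓞 K)) {e n : ℕ}
    (h : Ideal.absNorm v.asIdeal ^ e ∣ n) :
    ‖((n : ℕ) : v.adicCompletion K)‖₊ ≤ ((((Ideal.absNorm v.asIdeal : ℕ) : ℝ≥0) ^ e))⁻¹ := by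
  obtain ⟨m, rfl⟩ := h
  push_cast
  rw [nnnorm_mul, nnnorm_pow, ← inv_pow, ← mul_one ((((Ideal.absNorm v.asIdeal : ℕ) : ℝ≥0))⁻¹ ^ e)]
  refine mul_le_mul' (pow_le_pow_left' ?_ e) (nnnorm_natCast_le_one v m)
  simpa only [pow_one] using nnnorm_natCast_absNorm_le v

/-- Components of the finite adele `n · x`: `(n x)_v = n · x_v`. [folklore] -/
theorem natCast_mul_apply (n : ℕ) (x : FiniteAdeleRing (𝓞 K) K) (v : HeightOneSpectrum (𝓞 K)) :
    ((n : FiniteAdeleRing (𝓞 K) K) * x) v = (n : v.adicCompletion K) * x v := by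
  rw [FiniteAdeleRing.mul_apply']
  rfl

/-- Integrality test by absolute values: if `|n|_v · |x_v|_v ≤ 1` at every finite place then `n · x ∈ 𝒪̂_K`. [folklore] -/
theorem natCast_mul_mem_integralFiniteAdeles {n : ℕ} {x : FiniteAdeleRing (𝓞 K) K}
    (h : ∀ v : HeightOneSpectrum (𝓞 K), ‖(n : v.adicCompletion K)‖₊ * ‖x v‖₊ ≤ 1) :
    (n : FiniteAdeleRing (𝓞 K) K) * x ∈ integralFiniteAdeles K := by
  rw [mem_integralFiniteAdeles_iff]
  intro v
  rw [HeightOneSpectrum.mem_adicCompletionIntegers, ← Valued.toNormedField.norm_le_one_iff, natCast_mul_apply,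
    ← coe_nnnorm, ← NNReal.coe_one, NNReal.coe_le_coe, nnnorm_mul]
  exact h v

/-- **(F-a) The finite height is a natural number and a global denominator.** For `N ≥ 1` and
`y ∈ GL_N(𝔸_{K,f})` there is a natural number `n ≥ 1` with `n = H_f(y) = ∏_v H_v(y)` such that `n · y` and `n · y⁻¹`
have all their entries in `𝒪̂_K = ∏_v 𝒪_v`. Proof: `H_v(y) = q_v^{e_v}` (exactness) with `e_v = 0` off a finite set
`S` (★ `GLn.mulSupport_localHeight_finite_holds`); `n := ∏_{v ∈ S} q_v^{e_v}`; at each `v`, `q_v^{e_v} ∣ n` and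
`q_v ∈ v` give `|n|_v ≤ q_v^{-e_v} = H_v(y)^{-1}`, while `|y_{ij}|_v, |(y⁻¹)_{ij}|_v ≤ H_v(y)`.
[cite: MoeglinWaldspurger1995, §I.2.2] [cite: BorelJacquet1979, §1.2] -/
theorem exists_nat_eq_finprod_localHeight_forall_mul_mem [NeZero N]
    (y : GL (Fin N) (FiniteAdeleRing (𝓞 K) K)) :
    ∃ n : ℕ, 0 < n ∧ (n : ℝ) = ∏ᶠ v, (GLn.localHeight N K v (GLn.ofFinite N K y) : ℝ) ∧
      (∀ i j, (n : FiniteAdeleRing (𝓞 K) K) *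
          (y : Matrix (Fin N) (Fin N) (FiniteAdeleRing (𝓞 K) K)) i j ∈ integralFiniteAdeles K) ∧
      ∀ i j, (n : FiniteAdeleRing (𝓞 K) K) *
          ((y⁻¹ : GL (Fin N) (FiniteAdeleRing (𝓞 K) K)) :
            Matrix (Fin N) (Fin N) (FiniteAdeleRing (𝓞 K) K)) i j ∈ integralFiniteAdeles K := by
  classical
  set g := GLn.ofFinite N K y with hgdef
  choose e he using fun v : HeightOneSpectrum (𝓞 K) => exists_localHeight_eq_absNorm_pow v g
  have hS : (Function.mulSupport fun v => GLn.localHeight N K v g).Finite :=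
    GLn.mulSupport_localHeight_finite_holds g
  set S := hS.toFinset with hSdef
  set n : ℕ := ∏ v ∈ S, Ideal.absNorm v.asIdeal ^ e v with hndef
  have hq0 : ∀ v : HeightOneSpectrum (𝓞 K), 0 < Ideal.absNorm v.asIdeal := fun v =>
    lt_trans zero_lt_one (NumberField.HeightOneSpectrum.one_lt_absNorm v)
  have hn0 : 0 < n := Finset.prod_pos fun v _ => pow_pos (hq0 v) _
  -- `q_v^{e_v} ∣ n` at every place
  have hdvd : ∀ v : HeightOneSpectrum (𝓞 K), Ideal.absNorm v.asIdeal ^ e v ∣ n := by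
    intro v
    by_cases hv : v ∈ S
    · exact Finset.dvd_prod_of_mem _ hv
    · have h1 : GLn.localHeight N K v g = 1 := by
        simpa [hSdef, Function.mem_mulSupport] using hv
      rw [he v] at h1
      rw [eq_zero_of_absNorm_pow_eq_one v h1, pow_zero]
      exact one_dvd n
  -- `|n|_v · H_v(y) ≤ 1`
  have hkey : ∀ v : HeightOneSpectrum (𝓞 K),
      ‖(n : v.adicCompletion K)‖₊ * GLn.localHeight N K v g ≤ 1 := by
    intro v
    have hqe : (((Ideal.absNorm v.asIdeal : ℕ) : ℝ≥0) ^ e v) ≠ 0 :=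
      pow_ne_zero _ (NumberField.HeightOneSpectrum.absNorm_ne_zero v)
    calc ‖(n : v.adicCompletion K)‖₊ * GLn.localHeight N K v g
        ≤ ((((Ideal.absNorm v.asIdeal : ℕ) : ℝ≥0) ^ e v))⁻¹ *
            (((Ideal.absNorm v.asIdeal : ℕ) : ℝ≥0) ^ e v) := by
          rw [← he v]
          exact mul_le_mul' (he v ▸ nnnorm_natCast_le_of_dvd v (hdvd v)) le_rfl
      _ = 1 := inv_mul_cancel₀ hqe
  refine ⟨n, hn0, ?_, fun i j => ?_, fun i j => ?_⟩
  · -- `n = ∏ᶠ_v H_v(y)`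
    have hsub : (Function.mulSupport fun v => (GLn.localHeight N K v g : ℝ)) ⊆ S := by
      intro v hv
      rw [Function.mem_mulSupport] at hv
      rw [Finset.mem_coe, hSdef, Set.Finite.mem_toFinset, Function.mem_mulSupport]
      exact_mod_cast hv
    rw [finprod_eq_prod_of_mulSupport_subset _ hsub, hndef]
    push_cast
    refine Finset.prod_congr rfl fun v _ => ?_
    rw [he v]
    push_cast
    rfl
  · exact natCast_mul_mem_integralFiniteAdeles fun v =>
      (mul_le_mul' le_rfl (nnnorm_apply_le_localHeight v y i j)).trans (hkey v)
  · exact natCast_mul_mem_integralFiniteAdeles fun v =>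
      (mul_le_mul' le_rfl (nnnorm_inv_apply_le_localHeight v y i j)).trans (hkey v)

/-! ## §4 The separation lemma (F-b) -/

/-- Entries of the identity matrix are integral. [folklore] -/
theorem one_apply_mem_integralFiniteAdeles (i j : Fin N) :
    (1 : Matrix (Fin N) (Fin N) (FiniteAdeleRing (𝓞 K) K)) i j ∈ integralFiniteAdeles K := by
  rw [Matrix.one_apply]
  split_ifs
  · exact one_mem _
  · exact zero_mem _

/-- **(F-b) The separation lemma.** Let `y, y′ ∈ GL_N(𝔸_{K,f})` and `c ∈ 𝔸_{K,f}`. If `c · y⁻¹` and `c · y′⁻¹` have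
integral entries and `y′ ≡ y (mod c · M_N(𝒪̂_K))` (every entry of `y′ − y` is `c` times an integral adele), then
`y⁻¹ y′ ∈ GL_N(𝒪̂_K)`, i.e. `y GL_N(𝒪̂_K) = y′ GL_N(𝒪̂_K)`: indeed `y⁻¹y′ = 1 + (c y⁻¹) Z` and
`(y⁻¹y′)⁻¹ = y′⁻¹y = 1 − (c y′⁻¹) Z` with `y′ − y = c Z`, `Z` integral. No hypothesis on `N`, on `c`, or on the
integrality of `y, y′` themselves is needed. [cite: MoeglinWaldspurger1995, §I.2.2] -/
theorem inv_mul_mem_glFiniteIntegralLevel_of_sub_eq_mul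
    {y y' : GL (Fin N) (FiniteAdeleRing (𝓞 K) K)} {c : FiniteAdeleRing (𝓞 K) K}
    (hy : ∀ i j, c * ((y⁻¹ : GL (Fin N) (FiniteAdeleRing (𝓞 K) K)) :
      Matrix (Fin N) (Fin N) (FiniteAdeleRing (𝓞 K) K)) i j ∈ integralFiniteAdeles K)
    (hy' : ∀ i j, c * ((y'⁻¹ : GL (Fin N) (FiniteAdeleRing (𝓞 K) K)) :
      Matrix (Fin N) (Fin N) (FiniteAdeleRing (𝓞 K) K)) i j ∈ integralFiniteAdeles K)
    (hc : ∀ i j, ∃ z ∈ integralFiniteAdeles K,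
      (y' : Matrix (Fin N) (Fin N) (FiniteAdeleRing (𝓞 K) K)) i j -
        (y : Matrix (Fin N) (Fin N) (FiniteAdeleRing (𝓞 K) K)) i j = c * z) :
    y⁻¹ * y' ∈ glFiniteIntegralLevel N K := by
  classical
  choose z hz hzeq using hc
  set Z : Matrix (Fin N) (Fin N) (FiniteAdeleRing (𝓞 K) K) := Matrix.of fun i j => z i j with hZdef
  have hD : (y' : Matrix (Fin N) (Fin N) (FiniteAdeleRing (𝓞 K) K)) =
      (y : Matrix (Fin N) (Fin N) (FiniteAdeleRing (𝓞 K) K)) + c • Z := by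
    ext i j
    rw [Matrix.add_apply, Matrix.smul_apply, smul_eq_mul, hZdef, Matrix.of_apply, ← hzeq i j,
      add_sub_cancel]
  have hD' : (y : Matrix (Fin N) (Fin N) (FiniteAdeleRing (𝓞 K) K)) =
      (y' : Matrix (Fin N) (Fin N) (FiniteAdeleRing (𝓞 K) K)) - c • Z := by
    rw [hD, add_sub_cancel_right]
  rw [mem_glFiniteIntegralLevel_iff]
  refine ⟨fun i j => ?_, fun i j => ?_⟩
  · have h1 : ((y⁻¹ * y' : GL (Fin N) (FiniteAdeleRing (𝓞 K) K)) :
        Matrix (Fin N) (Fin N) (FiniteAdeleRing (𝓞 K) K)) =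
        1 + (c • ((y⁻¹ : GL (Fin N) (FiniteAdeleRing (𝓞 K) K)) :
          Matrix (Fin N) (Fin N) (FiniteAdeleRing (𝓞 K) K))) * Z := by
      rw [Units.val_mul, hD, Matrix.mul_add, Units.inv_mul, Matrix.mul_smul, Matrix.smul_mul]
    rw [h1, Matrix.add_apply, Matrix.mul_apply]
    refine add_mem (one_apply_mem_integralFiniteAdeles i j) (sum_mem fun k _ => mul_mem ?_ (hz k j))
    rw [Matrix.smul_apply, smul_eq_mul]
    exact hy i k
  · have h1 : (((y⁻¹ * y')⁻¹ : GL (Fin N) (FiniteAdeleRing (𝓞 K) K)) :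
        Matrix (Fin N) (Fin N) (FiniteAdeleRing (𝓞 K) K)) =
        1 - (c • ((y'⁻¹ : GL (Fin N) (FiniteAdeleRing (𝓞 K) K)) :
          Matrix (Fin N) (Fin N) (FiniteAdeleRing (𝓞 K) K))) * Z := by
      rw [mul_inv_rev, inv_inv, Units.val_mul, hD', Matrix.mul_sub, Units.inv_mul, Matrix.mul_smul,
        Matrix.smul_mul]
    rw [h1, Matrix.sub_apply, Matrix.mul_apply]
    refine sub_mem (one_apply_mem_integralFiniteAdeles i j) (sum_mem fun k _ => mul_mem ?_ (hz k j))
    rw [Matrix.smul_apply, smul_eq_mul]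
    exact hy' i k

/-- **(F-b), coset form.** Under the hypotheses of the separation lemma, `y′ = y · u` for some `u ∈ GL_N(𝒪̂_K)`.
[cite: MoeglinWaldspurger1995, §I.2.2] -/
theorem exists_mem_glFiniteIntegralLevel_eq_mul_of_sub_eq_mul
    {y y' : GL (Fin N) (FiniteAdeleRing (𝓞 K) K)} {c : FiniteAdeleRing (𝓞 K) K}
    (hy : ∀ i j, c * ((y⁻¹ : GL (Fin N) (FiniteAdeleRing (𝓞 K) K)) :
      Matrix (Fin N) (Fin N) (FiniteAdeleRing (𝓞 K) K)) i j ∈ integralFiniteAdeles K)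
    (hy' : ∀ i j, c * ((y'⁻¹ : GL (Fin N) (FiniteAdeleRing (𝓞 K) K)) :
      Matrix (Fin N) (Fin N) (FiniteAdeleRing (𝓞 K) K)) i j ∈ integralFiniteAdeles K)
    (hc : ∀ i j, ∃ z ∈ integralFiniteAdeles K,
      (y' : Matrix (Fin N) (Fin N) (FiniteAdeleRing (𝓞 K) K)) i j -
        (y : Matrix (Fin N) (Fin N) (FiniteAdeleRing (𝓞 K) K)) i j = c * z) :
    ∃ u ∈ glFiniteIntegralLevel N K, y' = y * u :=
  ⟨y⁻¹ * y', inv_mul_mem_glFiniteIntegralLevel_of_sub_eq_mul hy hy' hc, by rw [mul_inv_cancel_left]⟩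

/-- A non-zero natural number is a unit of the `K`-algebra `𝔸_{K,f}`. [folklore] -/
theorem isUnit_natCast_finiteAdeleRing {n : ℕ} (hn : n ≠ 0) :
    IsUnit (n : FiniteAdeleRing (𝓞 K) K) := by
  have h : (n : FiniteAdeleRing (𝓞 K) K) = algebraMap K (FiniteAdeleRing (𝓞 K) K) (n : K) := by
    rw [map_natCast]
  rw [h]
  exact (IsUnit.mk0 (n : K) (Nat.cast_ne_zero.2 hn)).map _

/-- **(F-b), the form of the plan**: for a natural number `n ≠ 0`, if `n · y⁻¹` and `n · y′⁻¹` are integral and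
`n · y ≡ n · y′ (mod n² M_N(𝒪̂_K))`, then `y⁻¹ y′ ∈ GL_N(𝒪̂_K)` (cancel the unit `n` of `𝔸_{K,f}` and apply the
separation lemma with `c = n`). This is why the residues of `n · y` modulo `n²` separate the cosets `y GL_N(𝒪̂_K)` of
height `n`. [cite: MoeglinWaldspurger1995, §I.2.2] -/
theorem inv_mul_mem_glFiniteIntegralLevel_of_natCast {n : ℕ} (hn : n ≠ 0)
    {y y' : GL (Fin N) (FiniteAdeleRing (𝓞 K) K)}
    (hy : ∀ i j, (n : FiniteAdeleRing (𝓞 K) K) * ((y⁻¹ : GL (Fin N) (FiniteAdeleRing (𝓞 K) K)) :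
      Matrix (Fin N) (Fin N) (FiniteAdeleRing (𝓞 K) K)) i j ∈ integralFiniteAdeles K)
    (hy' : ∀ i j, (n : FiniteAdeleRing (𝓞 K) K) * ((y'⁻¹ : GL (Fin N) (FiniteAdeleRing (𝓞 K) K)) :
      Matrix (Fin N) (Fin N) (FiniteAdeleRing (𝓞 K) K)) i j ∈ integralFiniteAdeles K)
    (hc : ∀ i j, ∃ z ∈ integralFiniteAdeles K,
      (n : FiniteAdeleRing (𝓞 K) K) * (y' : Matrix (Fin N) (Fin N) (FiniteAdeleRing (𝓞 K) K)) i j -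
        (n : FiniteAdeleRing (𝓞 K) K) * (y : Matrix (Fin N) (Fin N) (FiniteAdeleRing (𝓞 K) K)) i j =
          (n : FiniteAdeleRing (𝓞 K) K) ^ 2 * z) :
    y⁻¹ * y' ∈ glFiniteIntegralLevel N K := by
  refine inv_mul_mem_glFiniteIntegralLevel_of_sub_eq_mul hy hy' fun i j => ?_
  obtain ⟨z, hz, hzeq⟩ := hc i j
  refine ⟨z, hz, (isUnit_natCast_finiteAdeleRing (K := K) hn).mul_left_cancel ?_⟩
  rw [mul_sub, hzeq, sq, mul_assoc]

end Summit.HodgeConjecture.HodgeConjecture.Cruxes.HLiu418.K2LiuFiniteHeightCosetSeparation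

end
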